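import Summits.Ventures.Crystal3D.Theorems.StickyWulffConstantTextureLiminfTexShadowTerraceCensusDefs
import HarnessLib

/-!
# The jump count of the terrace census: telescoping along an up-slope line (input (J/Σ), cf-p1 RULING (ccxxxv)(ii); memo CENSUS-AUDIT-g18 §2)

HONEST FRAMING. Venture `Summits/Ventures/Crystal3D` (cell `crystal3d-full`), helper `--supports` the law-v5 crux `TextureLiminfV5`
(stmt-Ventures-23912), lane T, line `TexShadow` v8.16, registered stub `stub_terraceCensus` (mechanism (β)).  PURE BOOKKEEPING on the
real line — the «projection identity» of the census in the form the repaired assembly uses (memo CENSUS-AUDIT-g18 §2: charge the JUMPS of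
the terrace offsets across inter-patch defects, not the bad area).  Nothing about configurations; F-C1 not moved.

THE POINT.  Fix a twin-plane family `k` with unit normal `n` at inclination `θ` to the wall normal `e₃` (`sin θ = s`, `cos θ = c`), and a horizontal
line `ℓ` in the up-slope direction, arc length `t` (so the plane `{x : ⟪x, n⟫ = U}` crosses `ℓ`'s vertical plane at height `(U − t s)/c`).  A GOOD
interval `[a, b] ⊆ ℓ` is one over which the filling is a single rigid terrace patch crossing plane `k` at ONE offset `U`; the crossing must stay
inside the filling slab `z ∈ [z_lo, z_hi]` over the whole interval, i.e. `b s + z_lo c ≤ U ≤ a s + z_hi c` (`slabPinned`).  For good intervals met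
in order along `ℓ` the offsets therefore INCREASE overall, and the total variation of `U` across the bad gaps between them is at least
`(b_m − a_0) s − (z_hi − z_lo) c` — WHATEVER the lengths of the gaps (`sum_abs_sub_ge_of_slabPinned`).  With the local jump law (J) «a defect
across which the plane-`k` offset jumps by `ΔU` costs `≥ ½|ΔU|` per unit transverse length» (lane F's riser law read per height band, input
(F′)) this is `≥ ½ (L sin θ − H cos θ)` per line, i.e. `½ sin θ` per unit area after integrating over parallel lines, the `H cos θ` going to the rim
term `C(1+h)ρ` (`H = h + 2R₀`).  Also recorded: the weighted form (weights `λ_k ∈ [0,1]` per plane, memo §6c) is the same statement scaled.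
* `slabPinned s c zlo zhi a b U` — the slab constraint of a good interval;
* `sub_ge_of_slabPinned` — two pinned intervals in order: `U' − U ≥ (b' − a) s − (z_hi − z_lo) c` (one-step form); `half_span_le_sum_cost_of_jumpLaw` — with a per-gap cost `w i ≥ ½|ΔU i|` the line total is `≥ ½((b_m − a_0) s − (z_hi − z_lo) c)`;
* **`sum_abs_sub_ge_of_slabPinned`** — the telescoped total variation bound over `m + 1` good intervals met in order;
* `sum_abs_sub_ge_filling` — instantiated on the cell's filling slab `z ∈ [−R₀, h + R₀]` (`H = h + 2R₀`).
WHAT THIS IS NOT: the jump law (J), the patch structure (P1)/(P3), or any integration over lines; F-C1 not moved.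
-/

noncomputable section

open scoped BigOperators

namespace Summit.Ventures.Crystal3D.Cruxes.TextureLiminf.TexShadow

/-- **Slab pinning of a good interval.**  On the up-slope line with `sin θ = s`, `cos θ = c`, a rigid patch over the interval `[a, b]` crossing the
plane family at offset `U` keeps its crossing height `(U − t s)/c` inside `[zlo, zhi]` for all `t ∈ [a, b]`; for `c > 0` this is the pair of
inequalities recorded here (we record the consequences, valid for any sign conventions the assembly fixes). -/
def slabPinned (s c zlo zhi a b U : ℝ) : Prop :=
  b * s + zlo * c ≤ U ∧ U ≤ a * s + zhi * c

/-- One step: two pinned good intervals `[a, b]` before `[a', b']` force `U' − U ≥ (b' − a) s − (zhi − zlo) c`… in the useful weak form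
`U' − U ≥ b' s + zlo c − (a s + zhi c)`. -/
theorem sub_ge_of_slabPinned {s c zlo zhi a b U a' b' U' : ℝ} (h : slabPinned s c zlo zhi a b U) (h' : slabPinned s c zlo zhi a' b' U') :
    (b' - a) * s - (zhi - zlo) * c ≤ U' - U := by
  obtain ⟨-, h2⟩ := h
  obtain ⟨h1', -⟩ := h'
  nlinarith

/-- Telescoping of a real sequence under absolute values: `U m − U 0 ≤ Σ_{i<m} |U (i+1) − U i|`. -/
theorem sub_le_sum_abs_sub (U : ℕ → ℝ) (m : ℕ) : U m - U 0 ≤ ∑ i ∈ Finset.range m, |U (i + 1) - U i| := by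
  have h := Finset.sum_range_sub U m
  rw [← h]
  exact Finset.sum_le_sum fun i _ => le_abs_self _

/-- **THE JUMP COUNT (projection identity, telescoped form).**  Good intervals `[a i, b i]` (`i = 0, …, m`) met in order along an up-slope line,
each pinned in the slab with offset `U i`: the total variation of the offsets across the `m` gaps is at least `(b m − a 0) s − (zhi − zlo) c`,
independently of the gaps' lengths.  (Only the pinning of the FIRST and the LAST interval is used.) -/
theorem sum_abs_sub_ge_of_slabPinned {s c zlo zhi : ℝ} (a b U : ℕ → ℝ) (m : ℕ)
    (h0 : slabPinned s c zlo zhi (a 0) (b 0) (U 0)) (hm : slabPinned s c zlo zhi (a m) (b m) (U m)) :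
    (b m - a 0) * s - (zhi - zlo) * c ≤ ∑ i ∈ Finset.range m, |U (i + 1) - U i| :=
  (sub_ge_of_slabPinned h0 hm).trans (sub_le_sum_abs_sub U m)

/-- Weighted form (weights `λ ≥ 0` per plane family, memo CENSUS-AUDIT-g18 §6c): the same bound scaled. -/
theorem weighted_sum_abs_sub_ge_of_slabPinned {s c zlo zhi lam : ℝ} (hlam : 0 ≤ lam) (a b U : ℕ → ℝ) (m : ℕ)
    (h0 : slabPinned s c zlo zhi (a 0) (b 0) (U 0)) (hm : slabPinned s c zlo zhi (a m) (b m) (U m)) :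
    lam * ((b m - a 0) * s - (zhi - zlo) * c) ≤ ∑ i ∈ Finset.range m, lam * |U (i + 1) - U i| := by
  rw [← Finset.mul_sum]
  exact mul_le_mul_of_nonneg_left (sum_abs_sub_ge_of_slabPinned a b U m h0 hm) hlam

/-- **On the cell's filling slab** `z ∈ [−R₀, h + R₀]` (plates clamped below `−R₀` and above `h + R₀`, `H = h + 2R₀`): the jumps of plane family `k`
along an up-slope line whose first and last good intervals span `[a 0, b m]` have total variation `≥ (b m − a 0) sin θ − (h + 2R₀) cos θ`. -/
theorem sum_abs_sub_ge_filling {s c R₀ h : ℝ} (a b U : ℕ → ℝ) (m : ℕ)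
    (h0 : slabPinned s c (-R₀) (h + R₀) (a 0) (b 0) (U 0)) (hm : slabPinned s c (-R₀) (h + R₀) (a m) (b m) (U m)) :
    (b m - a 0) * s - (h + 2 * R₀) * c ≤ ∑ i ∈ Finset.range m, |U (i + 1) - U i| := by
  have := sum_abs_sub_ge_of_slabPinned a b U m h0 hm
  have e : (h + R₀ - -R₀) * c = (h + 2 * R₀) * c := by ring
  linarith [e]

/-- **Per-line census inequality, abstract form.**  If each gap `i < m` carries a cost `w i ≥ ½ |U (i+1) − U i|` (the local jump law (J) for this
plane family), then the line's total cost is `≥ ½ ((b m − a 0) s − (zhi − zlo) c)`. -/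
theorem half_span_le_sum_cost_of_jumpLaw {s c zlo zhi : ℝ} (a b U w : ℕ → ℝ) (m : ℕ)
    (h0 : slabPinned s c zlo zhi (a 0) (b 0) (U 0)) (hm : slabPinned s c zlo zhi (a m) (b m) (U m))
    (hJ : ∀ i < m, 1 / 2 * |U (i + 1) - U i| ≤ w i) :
    1 / 2 * ((b m - a 0) * s - (zhi - zlo) * c) ≤ ∑ i ∈ Finset.range m, w i := by
  have h1 := weighted_sum_abs_sub_ge_of_slabPinned (by norm_num : (0 : ℝ) ≤ 1 / 2) a b U m h0 hm
  exact h1.trans (Finset.sum_le_sum fun i hi => hJ i (Finset.mem_range.1 hi))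

end Summit.Ventures.Crystal3D.Cruxes.TextureLiminf.TexShadow

end
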